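import Literature.NumberTheory.EllipticCurves.LatticeInclusionIsogenyDegreeProofs
import Literature.NumberTheory.EllipticCurves.ManinConstantGamma1ModularDegree
import Literature.NumberTheory.EllipticCurves.ModularSymbolsLattice
import HarnessLib

/-!
# Line `star` on crux E1M (stmt-BirchSwinnertonDyer-20341), even-index residue: the SHIMURA EXPONENT LEMMAS

Lead star-p1 GEN 16.  Two elementary facts used by `Theorems/EisensteinDepletionAtTwoStarOptBSFShimuraExponent.lean`:

* `nsmul_mem_periodLatticeGamma1_of_pow` — if `u^e = 1` for every unit `u` of `ℤ/N` (e.g. `e = φ(N)`, or, for `N = pq`,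
  `e = (p−1)(q−1)/2`), then `e·Λ_f ⊆ Λ₁(f)`: Manin's homomorphism `γ ↦ {∞, γ∞}_f` on `Γ₀(N)` (tree `cuspSymbol_mul_holds`) gives
  `e·{∞,γ∞} = {∞, γ^e ∞}` and `γ^e ∈ Γ₁(N)` because the diagonal of `γ^e` is `(a^e, d^e) ≡ (1, 1) (mod N)`.  This is the
  lattice form of «the Shimura quotient `Λ_f/Λ₁(f)` is a quotient of `(ℤ/N)ˣ`» (Watkins 2002, Lemma 3.1; Ling–Oesterlé 1991).
* `exists_isogeny_nsmul_ker_eq_zero_of_isNeronLatticeOf` — the `ℚ`-isogeny of a rational lattice inclusion `cΛ₁ ⊆ Λ₂` (tree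
  `exists_isogeny_apply_eq_degree_eq_of_forall_mul_mem_lattice`, Silverman AEC VI.4.1(b)) has kernel killed by any `e` with
  `e·c⁻¹Λ₂ ⊆ Λ₁` (its kernel is `c⁻¹Λ₂/Λ₁` under the uniformisation).
* `pow_eq_one_of_units_zmod_mul` — for distinct odd primes `p, q` every unit `u` of `ℤ/pq` has `u^{(p−1)(q−1)/2} = 1` (CRT + Fermat).

Bookkeeping for an OPEN aside crux; nothing here reads `r_an`; StarOptB / E1M / BSD are NOT proved by this file.
-/

set_option linter.dupNamespace false
set_option autoImplicit false

noncomputable section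

open scoped Classical MatrixGroups
open CongruenceSubgroup
open WeierstrassCurve Literature.NumberTheory.EllipticCurves Literature.NumberTheory.EllipticCurves.ModularForms

namespace Summit.BirchSwinnertonDyer.BirchSwinnertonDyer.Theorems.DepletionAtTwo.ShimuraExp

/-! ### §1 `e·Λ_f ⊆ Λ₁(f)` when `e` kills `(ℤ/N)ˣ` -/

/-- Manin additivity iterated: `{∞, γⁿ∞}_f = n · {∞, γ∞}_f`. [cite: Manin1972, Prop. 1.4 / Thm. 1.6] -/
theorem cuspSymbol_pow {N : ℕ} [NeZero N] (f : CuspForm (Gamma0 N) 2) (γ : Gamma0 N) (n : ℕ) :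
    cuspSymbol f (γ ^ n) = (n : ℂ) * cuspSymbol f γ := by
  induction n with
  | zero => simp
  | succ n ih =>
    rw [pow_succ, cuspSymbol_mul_holds f, ih]
    push_cast
    ring

/-- For `γ ∈ Γ₀(N)` the lower-right entry `d = γ₁₁` is a unit mod `N` (`ad ≡ 1`). [folklore] -/
theorem isUnit_gamma0Map {N : ℕ} (γ : Gamma0 N) : IsUnit (Gamma0Map N γ) := by
  have hdet : ((γ : SL(2, ℤ)).1.det : ZMod N) = 1 := by simp only [(γ : SL(2, ℤ)).property, Int.cast_one]
  rw [Matrix.det_fin_two] at hdet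
  have h0 : (((γ : SL(2, ℤ)).1 1 0 : ℤ) : ZMod N) = 0 := Gamma0_mem.mp γ.property
  simp only [Int.cast_sub, Int.cast_mul, h0, mul_zero, sub_zero] at hdet
  exact IsUnit.of_mul_eq_one (((γ : SL(2, ℤ)).1 0 0 : ℤ) : ZMod N) (by rw [mul_comm]; exact hdet)

/-- **`e·Λ_f ⊆ Λ₁(f)` when `u^e = 1` for all units `u` of `ℤ/N`.**  For `γ ∈ Γ₀(N)` with lower-right entry `d`, `γ^e` has
lower-right entry `d^e ≡ 1 (mod N)` (`Gamma0Map` is a homomorphism), so `γ^e ∈ Γ₁(N)`, and `e·{∞,γ∞}_f = {∞,γ^e∞}_f ∈ Λ₁(f)`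
(Manin); `Λ_f` is the set of the `{∞,γ∞}_f` (tree `coe_periodLattice_eq_range`).  Lattice form of «`Λ_f/Λ₁(f)` is a quotient of
`(ℤ/N)ˣ`» (Watkins 2002, Lemma 3.1). [cite: Manin1972, Prop. 1.4] [cite: Watkins2002, Lemma 3.1] -/
theorem nsmul_mem_periodLatticeGamma1_of_pow {N : ℕ} [NeZero N] (f : CuspForm (Gamma0 N) 2) {e : ℕ}
    (he : ∀ u : (ZMod N)ˣ, u ^ e = 1) :
    ∀ w ∈ periodLattice f, (e : ℂ) * w ∈ periodLatticeGamma1 f := by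
  intro w hw
  have hw' : w ∈ (periodLattice f : Set ℂ) := hw
  rw [coe_periodLattice_eq_range] at hw'
  obtain ⟨γ, rfl⟩ := hw'
  rw [← cuspSymbol_pow]
  -- `γ^e ∈ Γ₁(N)`: its lower-right entry is `d^e = 1`
  have h1' : γ ^ e ∈ Gamma1' N := by
    obtain ⟨u, hu⟩ := isUnit_gamma0Map γ
    rw [Gamma1_mem', map_pow, ← hu, ← Units.val_pow_eq_pow_val, he, Units.val_one]
  obtain ⟨h00, h11, h10⟩ := (Gamma1_to_Gamma0_mem (γ ^ e)).mp h1'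
  have hmem : ((γ ^ e : Gamma0 N) : SL(2, ℤ)) ∈ Gamma1 N := (Gamma1_mem N _).mpr ⟨h00, h11, h10⟩
  exact cuspSymbol_mem_periodLatticeGamma1 f ⟨((γ ^ e : Gamma0 N) : SL(2, ℤ)), hmem⟩

/-- Special case `e = φ(N)` (Euler): `φ(N)·Λ_f ⊆ Λ₁(f)`. [cite: Watkins2002, Lemma 3.1] -/
theorem totient_nsmul_mem_periodLatticeGamma1 {N : ℕ} [NeZero N] (f : CuspForm (Gamma0 N) 2) :
    ∀ w ∈ periodLattice f, (Nat.totient N : ℂ) * w ∈ periodLatticeGamma1 f :=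
  nsmul_mem_periodLatticeGamma1_of_pow f fun u ↦ ZMod.pow_totient u

/-! ### §2 Units of `ℤ/pq` are killed by `(p−1)(q−1)/2` -/

/-- For distinct primes `p, q`, every unit of `ℤ/(pq)` satisfies `u^{m} = 1` as soon as `p − 1 ∣ m` and `q − 1 ∣ m`
(CRT + Fermat). [folklore] -/
theorem units_zmod_pow_eq_one_of_dvd {p q : ℕ} (hp : p.Prime) (hq : q.Prime) (hpq : p ≠ q) {m : ℕ}
    (hpm : p - 1 ∣ m) (hqm : q - 1 ∣ m) (u : (ZMod (p * q))ˣ) : u ^ m = 1 := by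
  have hcop : Nat.Coprime p q := (Nat.coprime_primes hp hq).mpr hpq
  haveI : Fact p.Prime := ⟨hp⟩
  haveI : Fact q.Prime := ⟨hq⟩
  -- the CRT isomorphism
  let e : ZMod (p * q) ≃+* ZMod p × ZMod q := ZMod.chineseRemainder hcop
  -- images of the unit are units
  have hu : IsUnit (u : ZMod (p * q)) := u.isUnit
  have hup : IsUnit ((e (u : ZMod (p * q))).1) := (hu.map e).map (RingHom.fst _ _)
  have huq : IsUnit ((e (u : ZMod (p * q))).2) := (hu.map e).map (RingHom.snd _ _)
  have h1 : (e (u : ZMod (p * q))).1 ^ m = 1 := by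
    have hne : (e (u : ZMod (p * q))).1 ≠ 0 := hup.ne_zero
    obtain ⟨k, hk⟩ := hpm
    rw [hk, pow_mul, ZMod.pow_card_sub_one_eq_one hne, one_pow]
  have h2 : (e (u : ZMod (p * q))).2 ^ m = 1 := by
    have hne : (e (u : ZMod (p * q))).2 ≠ 0 := huq.ne_zero
    obtain ⟨k, hk⟩ := hqm
    rw [hk, pow_mul, ZMod.pow_card_sub_one_eq_one hne, one_pow]
  have h12 : e ((u : ZMod (p * q)) ^ m) = 1 := by
    rw [map_pow]
    ext
    · rw [Prod.pow_fst, h1]; rfl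
    · rw [Prod.pow_snd, h2]; rfl
  have h : (u : ZMod (p * q)) ^ m = 1 := by
    have := congrArg e.symm h12
    rwa [RingEquiv.symm_apply_apply, map_one] at this
  exact Units.ext (by rw [Units.val_pow_eq_pow_val, h, Units.val_one])

/-- **`N = pq` with `p ≡ q ≡ 3 (mod 4)`: the Shimura exponent is `2 × odd`.**  For distinct primes `p, q ≡ 3 (mod 4)` there is an odd
`d` with `(2d)·Λ_f ⊆ Λ₁(f)` for every `f ∈ S₂(Γ₀(pq))`: take `2d = (p−1)(q−1)/2`. [cite: Watkins2002, Lemma 3.1] -/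
theorem exists_odd_two_mul_nsmul_mem_periodLatticeGamma1 {p q : ℕ} (hp : p.Prime) (hq : q.Prime) (hpq : p ≠ q)
    (hp4 : p % 4 = 3) (hq4 : q % 4 = 3) [NeZero (p * q)] (f : CuspForm (Gamma0 (p * q)) 2) :
    ∃ d : ℕ, Odd d ∧ ∀ w ∈ periodLattice f, ((2 * d : ℕ) : ℂ) * w ∈ periodLatticeGamma1 f := by
  -- `p − 1 = 2a`, `q − 1 = 2b` with `a, b` odd
  obtain ⟨a, ha⟩ : ∃ a, p - 1 = 2 * a := ⟨(p - 1) / 2, by omega⟩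
  obtain ⟨b, hb⟩ : ∃ b, q - 1 = 2 * b := ⟨(q - 1) / 2, by omega⟩
  have hao : Odd a := by
    rw [Nat.odd_iff]; omega
  have hbo : Odd b := by
    rw [Nat.odd_iff]; omega
  refine ⟨a * b, hao.mul hbo, ?_⟩
  refine nsmul_mem_periodLatticeGamma1_of_pow f fun u ↦ units_zmod_pow_eq_one_of_dvd hp hq hpq ?_ ?_ u
  · rw [ha]; exact ⟨b, by ring⟩
  · rw [hb]; exact ⟨a, by ring⟩

/-! ### §3 The lattice isogeny has kernel killed by the Shimura exponent -/

/-- **The `ℚ`-isogeny of a rational lattice inclusion `cΛ₁ ⊆ Λ₂` has kernel killed by `e` whenever `e·c⁻¹Λ₂ ⊆ Λ₁`.**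
For elliptic `W₁, W₂/ℚ` with Néron period pairs `L₁, L₂`, `c ∈ ℚˣ` with `cΛ₁ ⊆ Λ₂`, and `e ∈ ℕ` with `e·z ∈ Λ₁` for every `z`
with `cz ∈ Λ₂`: there is a `ℚ`-isogeny `φ : W₁ → W₂` (the analytic `z ↦ cz`, tree
`exists_isogeny_apply_eq_degree_eq_of_forall_mul_mem_lattice`) with `e • m = 0` for every `m ∈ ker φ`, and
`deg φ = [c⁻¹Λ₂ : Λ₁]`: a point `m` with `j_* m = u₁ z` and `φ m = 0` has `u₂(cz) = 0`, i.e. `cz ∈ Λ₂`, so `ez ∈ Λ₁` and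
`j_*(e • m) = u₁(ez) = 0`. [cite: SilvermanAEC2009, Thm. VI.4.1(b) (PDF pp. 152–154) and III.4.10(c)] -/
theorem exists_isogeny_nsmul_ker_eq_zero_of_isNeronLatticeOf (W₁ W₂ : WeierstrassCurve ℚ) [W₁.IsElliptic]
    {L₁ L₂ : PeriodPair} (hL₁ : IsNeronLatticeOf (W₁.baseChange ℂ) L₁)
    (hL₂ : IsNeronLatticeOf (W₂.baseChange ℂ) L₂) {c : ℚ} (hc : c ≠ 0)
    (hle : ∀ z ∈ L₁.lattice, (c : ℂ) * z ∈ L₂.lattice) {e : ℕ}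
    (hkill : ∀ z : ℂ, (c : ℂ) * z ∈ L₂.lattice → (e : ℂ) * z ∈ L₁.lattice) :
    ∃ φ : Isogeny W₁ W₂, (∀ m : W₁.geomPoints, φ m = 0 → e • m = 0) ∧
      φ.degree = L₁.lattice.toAddSubgroup.relIndex (L₂.lattice.toAddSubgroup.comap (AddMonoidHom.mulLeft (c : ℂ))) := by
  obtain ⟨u₁, hker₁, hsurj₁, hu₁⟩ := L₁.exists_addMonoidHom_of_g₂_g₃' hL₁.1 hL₁.2
  obtain ⟨u₂, hker₂, -, hu₂⟩ := L₂.exists_addMonoidHom_of_g₂_g₃' hL₂.1 hL₂.2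
  haveI hQbar : Algebra.IsAlgebraic ℚ (AlgebraicClosure ℚ) := AlgebraicClosure.isAlgebraic ℚ
  obtain ⟨j⟩ : Nonempty ((AlgebraicClosure ℚ) →ₐ[ℚ] ℂ) := ⟨IsAlgClosed.lift⟩
  obtain ⟨φ, happ, hdeg⟩ := exists_isogeny_apply_eq_degree_eq_of_forall_mul_mem_lattice hL₁.1 hL₁.2 hL₂.1
    hL₂.2 u₁ hker₁ hsurj₁ hu₁ u₂ hker₂ hu₂ j hc hle
  refine ⟨φ, fun m hm ↦ ?_, hdeg⟩
  set jW₁ := (Affine.Point.map (W' := W₁) j : W₁.geomPoints →+ (W₁.baseChange ℂ).toAffine.Point) with hjW₁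
  set jW₂ := (Affine.Point.map (W' := W₂) j : W₂.geomPoints →+ (W₂.baseChange ℂ).toAffine.Point) with hjW₂
  have hj₁ : Function.Injective jW₁ := Affine.Point.map_injective (W' := W₁) j
  have hu₁0 : ∀ z, u₁ z = 0 ↔ z ∈ L₁.lattice := fun z ↦ by
    rw [← SetLike.mem_coe, ← hker₁, SetLike.mem_coe, AddMonoidHom.mem_ker]
  have hu₂0 : ∀ z, u₂ z = 0 ↔ z ∈ L₂.lattice := fun z ↦ by
    rw [← SetLike.mem_coe, ← hker₂, SetLike.mem_coe, AddMonoidHom.mem_ker]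
  obtain ⟨z, hz⟩ := hsurj₁ (jW₁ m)
  have h2 : jW₂ (φ m) = u₂ ((c : ℂ) * z) := happ m z hz.symm
  have hcz : (c : ℂ) * z ∈ L₂.lattice := by
    rw [← hu₂0, ← h2, hm]
    exact map_zero jW₂
  have hez : u₁ ((e : ℂ) * z) = 0 := (hu₁0 _).mpr (hkill z hcz)
  apply hj₁
  have h1 : jW₁ (e • m) = e • jW₁ m := map_nsmul jW₁ e m
  have h3 : e • jW₁ m = u₁ ((e : ℂ) * z) := by rw [← hz, ← map_nsmul, nsmul_eq_mul]
  exact (h1.trans (h3.trans hez)).trans (map_zero jW₁).symm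

end Summit.BirchSwinnertonDyer.BirchSwinnertonDyer.Theorems.DepletionAtTwo.ShimuraExp

end
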